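import Literature.NumberTheory.EllipticCurves.BurungaleCastellaGrossiSkinner2026.RefinedKolyvaginConjecture
import Literature.NumberTheory.EllipticCurves.HeegnerPointsKolyvaginTorsionProofs
import Literature.NumberTheory.EllipticCurves.HeegnerPointsKolyvaginPrimitivity
import Literature.NumberTheory.EllipticCurves.HeegnerPointsKolyvaginLevelOneStructure
import Literature.NumberTheory.EllipticCurves.HeegnerPointsKolyvaginModPRigidity
import HarnessLib

/-!
# Route `KolyvaginDepthDoor`, crux `KolyvaginDepthSupplyKN` (stmt-BirchSwinnertonDyer-22820) —
# THE MOD-`p` STRUCTURE STATEMENT ON THE KODAIRA–NÉRON CELL, RESIDUAL CLASS INCLUDED, FROM PRINT: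
# Howard 2004 / Zanarella 2019 rigidity of the mod-`p` Heegner-point Kolyvagin system at core vertices

Helper file of the lead prover of line `levelone` (kdd-p1 g13; `--supports stmt-BirchSwinnertonDyer-22820
--as helper`); route-free (no `Theses` import); it closes nothing and BSD is not proved by it.

Skeleton v6 of the line leaves, besides the one open stub (`Ш(E)[p] = 0` eventually at analytic rank
`≥ 2`) and print facts by name, the RESIDUAL STRUCTURE STUB `stub_modPStructureResidualRankTwo`: per
`(E, p, K)` on the Kodaira–Néron cell, a LEVEL-ONE class `c_1(n) ≠ 0`, `n ∈ Λ`, with `#Sel_p(E/ℚ) =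
p^{ν(n)+1}` or `#Sel_p(E^{(d_K)}/ℚ) = p^{ν(n)+1}` — the SHAPE of W. Zhang 2014 Lemma 8.4 (1) + Thm. 9.1
without his Hypothesis ♠ (2). The g12 file `KolyvaginDepthDoorKNSupplyResidualPrimitivity` gave its
first half (Burungale–Castella–Grossi–Skinner 2026 Thm. 2 + Zanarella 2019 Prop. 2.18: the mod-`p`
system `{c_1(n)}` is NON-ZERO on a `p`-optimal frame with `p` split in `K`). This file supplies the
second half, the DEPTH: the named fact
`Literature.NumberTheory.EllipticCurves.HowardZanarella_exists_minimal_kolyvaginClass_one_selmerCard_of_ne_zero`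
(file `Literature/NumberTheory/EllipticCurves/HeegnerPointsKolyvaginModPRigidity`, p675362, filed by this seat) — Howard's structure theorem
`𝓗(n) ≃ R^ε ⊕ M(n) ⊕ M(n)` and stub lemma `κ_n ∈ 𝒮(n)`, with Zanarella's connectedness of the graph of
core vertices and Čebotarev descent `r(nl) < r(n)`, read at `R = 𝔽_p`: IF the mod-`p` system is
non-zero, THEN its vanishing order is `ν = max(dim Sel_p(E/ℚ), dim Sel_p(E^{(d_K)}/ℚ)) − 1` and the
Lemma 8.4 (1) dichotomy holds — with NO Hypothesis ♠ (2), no square-free `N`, no level raising.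

* `exists_minimal_kolyvaginClass_one_selmerCard_of_thm2_of_zanarella_of_rigidity` — PROVED from
  the three named facts: for `E/ℚ` globally minimal, `p ≥ 5` good ordinary with `ρ̄_{E,p}` and the
  tower `ρ_{E,p^n}` onto and `p ∤ Tam_E`, `K` imaginary quadratic Heegner with `d_K` odd, `≠ −3, −4`,
  `p ∤ d_K`, `(d_K, N) = 1`, `p` split in `K`, and a `p`-OPTIMAL frame `(Dt, β, ι)`: a level-one
  class `c_1(n) ≠ 0`, `n ∈ Λ`, of MINIMAL depth, with the Lemma 8.4 (1) dichotomy on `#Sel_p(E/ℚ)`,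
  `#Sel_p(E^{(d_K)}/ℚ)`.
* `exists_kolyvaginClass_one_selmerCard_of_print` — the same, trimmed to the residual stub's
  conclusion shape (`KolSupp ∧ c_1(n) ≠ 0 ∧ (#Sel_p(E) = p^{ν+1} ∨ #Sel_p(E^{(d_K)}) = p^{ν+1})`)
  for SOME `p`-optimal frame, given that one exists (`hopt`, the line's bookkeeping gap (a)).

CONDITIONAL on the three named facts (print; XL to formalise); the `p`-optimal frame is a
hypothesis; BSD is NOT proved by this.

References: [Howard2004] B. Howard, *The Heegner point Kolyvagin system*, Compos. Math. 140 (2004)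
1439–1472 = arXiv:1202.6340 (held `paper:arxiv-1202.6340`; Compositio numbering `1.x.y` = the held
text's `2.x.y`): Def. 1.2.1–1.2.2, §1.3 (H.0–H.5), Thm. 1.4.2, Def. 1.5.2, Lemma 1.5.3, Def. 1.5.4,
Prop. 1.5.5, Lemma 1.6.4, Thm. 1.6.5 (proof), §1.7 with Thm. 1.7.5; [Zanarella2019] M. Zanarella,
*On Howard's main conjecture and the Heegner point Kolyvagin system*, arXiv:1908.09197 (held): §2.1,
Lemma 2.2, Def. 2.4, Def. 2.7, Lemma 2.8, Cor. 2.12, Thm. 2.13, Cor. 2.14, Prop. 2.15, Def. 2.17,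
Prop. 2.18, Rem. 2.20, §3.1; [Kolyvagin1991MathAnn] §2 (the eigenspaces as Selmer groups over `ℚ`);
[WZhang2014] Def. 8.3, Lemma 8.4 (1) (p. 236), Notations (xii); [BurungaleEtAl2026] Thm. 2;
[GrossLMS1991] §3–§4.
-/

-- D-0017: single-problem summit, `Summit.BirchSwinnertonDyer.BirchSwinnertonDyer.…` repeats a namespace BY DESIGN.
set_option linter.dupNamespace false

noncomputable section

open scoped Classical

namespace Summit.BirchSwinnertonDyer.BirchSwinnertonDyer.Theorems.KolyvaginDepthDoor

open Literature.NumberTheory.EllipticCurves Literature.NumberTheory.EllipticCurves.ModularForms WeierstrassCurve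

/-- **The mod-`p` structure statement on the Kodaira–Néron cell, residual class included, FROM PRINT
(minimal-depth form).** For `E/ℚ` globally minimal, `p ≥ 5` good ordinary with `ρ̄_{E,p}` onto, the
tower `ρ_{E,p^n}` onto and `p ∤ Tam_E = ∏_ℓ c_ℓ` (automatic on the Kodaira–Néron cell), `K` imaginary
quadratic with the Heegner hypothesis for `N_E`, `d_K` odd, `d_K ≠ −3, −4`, `(d_K, N_E) = 1`,
`p ∤ d_K`, `p` SPLIT in `K`, and a `p`-OPTIMAL frame `(Dt, β, ι)`: there are `n ∈ Λ` and a datum `d`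
of conductor `n` with `c_1(n) ≠ 0` in `H¹(K, E[p])`, `ν(n)` minimal among the non-zero level-one
classes of the frame, and `#Sel_p(E/ℚ) = p^{ν(n)+1} ∧ #Sel_p(E^{(d_K)}/ℚ) ≤ p^{ν(n)}` or the mirror
statement. Proof: `E(K)[p] = 0` (`ρ̄` onto), BCGS Thm. 2 at `t = ord_p(Tam_E) = 0` gives a class
`c_{M(n)}(n)` not divisible by `p`, Zanarella Prop. 2.18 makes the mod-`p` system non-zero (the g12
chain of `exists_kolyvaginClass_one_ne_zero_of_thm2_of_zanarella`, re-run here to keep this file in the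
Literature import cone), and the Howard–Zanarella rigidity fact gives depth and dichotomy. NO
Hypothesis ♠ (2), no square-free `N`, no level raising. CONDITIONAL on the three named facts.
[cite: BurungaleEtAl2026, Thm. 2 (arXiv:2312.09301 §0.1)] [cite: Zanarella2019, Prop. 2.18, Cor. 2.12, Cor. 2.14, Prop. 2.15 (arXiv:1908.09197 §2)]
[cite: Howard2004, Thm. 1.4.2, Prop. 1.5.5, Lemma 1.6.4] [cite: WZhang2014, Lemma 8.4 (1) (p. 236)] -/
theorem exists_minimal_kolyvaginClass_one_selmerCard_of_thm2_of_zanarella_of_rigidity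
    (h2 : BurungaleEtAl2026.thm2_kolyvaginClass_divisibility_eq_padicValNat_tamagawaProduct)
    (hZ : Literature.NumberTheory.EllipticCurves.Zanarella2019_kolyvaginClass_one_ne_zero_of_not_divisible)
    (hHZ : Literature.NumberTheory.EllipticCurves.HowardZanarella_exists_minimal_kolyvaginClass_one_selmerCard_of_ne_zero)
    (W : WeierstrassCurve ℚ) [W.IsElliptic] [W.IsGloballyMinimal] (p : ℕ) [hp : Fact p.Prime]
    (h5 : 5 ≤ p) (hgood : W.HasGoodReductionAtPrime p) (hord : ¬ (p : ℤ) ∣ W.frobeniusTrace p)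
    (hsur : W.HasSurjectiveModNGaloisRep p) (htower : ∀ n : ℕ, W.HasSurjectiveModNGaloisRep (p ^ n : ℕ))
    (htam : ¬ p ∣ W.tamagawaProduct)
    (K : Type) [Field K] [NumberField K] (hK : IsImaginaryQuadratic K)
    [NeZero (W.conductorNorm ℤ)] (hHeeg : SatisfiesHeegnerHypothesis (W.conductorNorm ℤ) K)
    (hodd : Odd (NumberField.discr K)) (hD3 : NumberField.discr K ≠ -3) (hD4 : NumberField.discr K ≠ -4)
    (hDN : IsCoprime (NumberField.discr K) ((W.conductorNorm ℤ : ℕ) : ℤ))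
    (hpD : ¬ ((p : ℤ) ∣ NumberField.discr K)) (hspl : SatisfiesHeegnerHypothesis p K)
    (Dt : ModularParametrizationData W (W.conductorNorm ℤ)) (hopt : Dt.IsPOptimal p)
    (β : ℤ) (hβ : (4 * (W.conductorNorm ℤ : ℤ)) ∣ β ^ 2 - NumberField.discr K) (ι : K →+* ℂ) :
    ∃ (n : ℕ) (d : KolyvaginHeegnerData Dt β ι n),
      KolyvaginDescent.KolSupp (Zhang2014.IsKolyvaginPrime (W.conductorNorm ℤ) W K p) n ∧
        d.kolyvaginClass hp.out 1 ≠ 0 ∧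
        (∀ (n' : ℕ) (d' : KolyvaginHeegnerData Dt β ι n'),
          KolyvaginDescent.KolSupp (Zhang2014.IsKolyvaginPrime (W.conductorNorm ℤ) W K p) n' →
          d'.kolyvaginClass hp.out 1 ≠ 0 → n.primeFactors.card ≤ n'.primeFactors.card) ∧
        ((Nat.card (W.selmerGroup p) = p ^ (n.primeFactors.card + 1) ∧
            Nat.card ((W.quadraticTwist (NumberField.discr K : ℚ)).selmerGroup p) ≤
              p ^ n.primeFactors.card) ∨
          (Nat.card ((W.quadraticTwist (NumberField.discr K : ℚ)).selmerGroup p) =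
              p ^ (n.primeFactors.card + 1) ∧
            Nat.card (W.selmerGroup p) ≤ p ^ n.primeFactors.card)) := by
  have hpP : p.Prime := hp.out
  have h3 : 3 < p := by omega
  -- `d_K < −4`: an odd imaginary quadratic discriminant other than `−3` is `≤ −7`
  have hlt : NumberField.discr K < -4 := by
    have hgt : 2 < |NumberField.discr K| :=
      NumberField.abs_discr_gt_two (by rw [hK.1]; exact one_lt_two)
    rw [abs_of_neg hK.discr_neg] at hgt
    obtain ⟨r, hr⟩ := hodd
    omega
  -- (tor): `E(K)[p] = 0` from surjectivity
  have htor : AddSubgroup.torsionBy (W.baseChange K).toAffine.Point (p : ℤ) = ⊥ :=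
    torsionBy_eq_bot_of_isImaginaryQuadratic W K hK hpP (by omega) hsur
  -- BCGS Thm. 2, (≤) half at `t = ord_p(Tam_E) = 0`: some class `c_{M(n)}(n)` is not divisible by `p`
  obtain ⟨-, n, d, M, hn1, hsupp, hM, hndiv⟩ :=
    h2 W p h3 hgood hord hsur K hK hHeeg hodd hD3 htor hspl Dt hopt β hβ ι
  have ht : padicValNat p W.tamagawaProduct = 0 := padicValNat.eq_zero_of_not_dvd htam
  rw [ht, zero_add, pow_one] at hndiv
  -- Zanarella Prop. 2.18: the mod-`p` system is non-zero
  have hne := hZ W p h5 hgood hord hsur K hK hlt hpD hDN hHeeg Dt β ι n d M hn1 hsupp hM hndiv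
  -- Howard–Zanarella rigidity: minimal depth and the Lemma 8.4 (1) dichotomy
  exact hHZ W p h5 hgood hsur htower K hK hD3 hD4 hpD hDN hHeeg Dt β ι hne

/-- **The residual structure stub's conclusion FROM PRINT, given a `p`-optimal frame** (the shape
consumed by `levelOne_kolyvaginClass_rankClause_of_structure` and by the v5/v6 compositions): under
the hypotheses of the previous theorem, but with the `p`-optimal parametrisation datum existential
(`hopt`) and the orientation produced from the Heegner hypothesis, there are a frame `(Dt, β, ι)`,
`n ∈ Λ` and a datum `d` of conductor `n` with `c_1(n) ≠ 0` and `#Sel_p(E/ℚ) = p^{ν(n)+1} ∨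
#Sel_p(E^{(d_K)}/ℚ) = p^{ν(n)+1}`. CONDITIONAL on the three named facts; BSD is not proved by it.
[cite: BurungaleEtAl2026, Thm. 2] [cite: Zanarella2019, Prop. 2.18, Cor. 2.14] [cite: Howard2004, Lemma 1.6.4] -/
theorem exists_kolyvaginClass_one_selmerCard_of_print
    (h2 : BurungaleEtAl2026.thm2_kolyvaginClass_divisibility_eq_padicValNat_tamagawaProduct)
    (hZ : Literature.NumberTheory.EllipticCurves.Zanarella2019_kolyvaginClass_one_ne_zero_of_not_divisible)
    (hHZ : Literature.NumberTheory.EllipticCurves.HowardZanarella_exists_minimal_kolyvaginClass_one_selmerCard_of_ne_zero)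
    (W : WeierstrassCurve ℚ) [W.IsElliptic] [W.IsGloballyMinimal] (p : ℕ) [hp : Fact p.Prime]
    (h5 : 5 ≤ p) (hgood : W.HasGoodReductionAtPrime p) (hord : ¬ (p : ℤ) ∣ W.frobeniusTrace p)
    (hsur : W.HasSurjectiveModNGaloisRep p) (htower : ∀ n : ℕ, W.HasSurjectiveModNGaloisRep (p ^ n : ℕ))
    (htam : ¬ p ∣ W.tamagawaProduct)
    (K : Type) [Field K] [NumberField K] (hK : IsImaginaryQuadratic K)
    [NeZero (W.conductorNorm ℤ)] (hHeeg : SatisfiesHeegnerHypothesis (W.conductorNorm ℤ) K)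
    (hodd : Odd (NumberField.discr K)) (hD3 : NumberField.discr K ≠ -3) (hD4 : NumberField.discr K ≠ -4)
    (hDN : IsCoprime (NumberField.discr K) ((W.conductorNorm ℤ : ℕ) : ℤ))
    (hpD : ¬ ((p : ℤ) ∣ NumberField.discr K)) (hspl : SatisfiesHeegnerHypothesis p K)
    (hopt : ∃ Dt : ModularParametrizationData W (W.conductorNorm ℤ), Dt.IsPOptimal p) :
    ∃ (Dt : ModularParametrizationData W (W.conductorNorm ℤ)) (β : ℤ) (ι : K →+* ℂ) (n : ℕ)
      (d : KolyvaginHeegnerData Dt β ι n),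
      KolyvaginDescent.KolSupp (Zhang2014.IsKolyvaginPrime (W.conductorNorm ℤ) W K p) n ∧
        d.kolyvaginClass hp.out 1 ≠ 0 ∧
        (Nat.card (W.selmerGroup p) = p ^ (n.primeFactors.card + 1) ∨
          Nat.card ((W.quadraticTwist (NumberField.discr K : ℚ)).selmerGroup p) =
            p ^ (n.primeFactors.card + 1)) := by
  obtain ⟨Dt, hDt⟩ := hopt
  obtain ⟨β, hβ⟩ := exists_dvd_sq_sub_discr_holds (W.conductorNorm ℤ) K hK hHeeg
  obtain ⟨ι⟩ : Nonempty (K →+* ℂ) := inferInstance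
  obtain ⟨n, d, hsupp, hne, -, hdich⟩ :=
    exists_minimal_kolyvaginClass_one_selmerCard_of_thm2_of_zanarella_of_rigidity h2 hZ hHZ W p h5
      hgood hord hsur htower htam K hK hHeeg hodd hD3 hD4 hDN hpD hspl Dt hDt β hβ ι
  refine ⟨Dt, β, ι, n, d, hsupp, hne, ?_⟩
  rcases hdich with ⟨h, -⟩ | ⟨h, -⟩
  · exact Or.inl h
  · exact Or.inr h

end Summit.BirchSwinnertonDyer.BirchSwinnertonDyer.Theorems.KolyvaginDepthDoor

end
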